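import Summits.Langlands.Langlands.Theses.PhantomRMYoshida

/-!
# Route PhantomRMYoshida — SectorGlue (item stmt-Langlands-14471)

The glue item of route `PhantomRMYoshida` for the Langlands summit:
`SerreKWAutomorphicGL2 → StableYoshidaCongruence → ResiduallyYoshidaLifting → PhantomRMSector`.

The glue carries no mathematics by design (D-0019 thin route): it is "cruxes ⟹ target sector"
by pure instantiation.  Fix the data `p, k, red, σ, σ', hcpt, ι, ρ` and the hypotheses of the
sector `PhantomRMSector`.  Serre–Khare–Wintenberger automorphy on `GL₂` (`SerreKWAutomorphicGL2`)
applied to `σ` and to `σ'` (both odd and irreducible) discharges the two `GL₂`-automorphy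
hypotheses of `StableYoshidaCongruence`; its "some `ρ` of shape `Sh`" hypothesis is witnessed by
the sector's own `ρ`; it returns an irreducible automorphic `ρ₀` of the same symplectic /
Greenberg-ordinary / residually-Yoshida shape, and `ResiduallyYoshidaLifting` moves automorphy
from `ρ₀` to `ρ`.  Every hypothesis is passed on syntactically (the `let εb / Sh / Aut`
abbreviations of the route decls zeta-reduce to the target's clauses).  This is literally the
inner λ-term of the route file's deciding theorem
`Summit.Langlands.Langlands.Theses.PhantomRMYoshida.closes`; composed with `PhantomRMJunction`
it gives the route's `Assembly`.
-/

set_option linter.dupNamespace false -- project-wide option (lakefile weak.linter.dupNamespace); `Summit.Langlands.Langlands` is the mandated namespace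

namespace Summit.Langlands.Langlands.Theorems.PhantomRMYoshida

open Summit.Langlands.Langlands.Theses.PhantomRMYoshida

/-- **Cruxes ⟹ target sector.** From Serre–Khare–Wintenberger automorphy on `GL₂`
(`hKW : SerreKWAutomorphicGL2`), the endoscopic-to-stable congruence
(`hS : StableYoshidaCongruence`) and relative automorphy lifting at a residually-Yoshida point
(`hL : ResiduallyYoshidaLifting`), the sector `PhantomRMSector` follows: for `p` odd,
`σ σ' : Γ_ℚ → GL₂(k)` odd, irreducible, of determinant `ε̄⁻¹`, non-conjugate, and
`ρ : Γ_ℚ → GL₄(ℚ̄_p)` irreducible, symplectic with multiplier `ε⁻¹`, Greenberg-ordinary of shape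
`(0,0,1,1)` and residually distinguished above `p`, with a.e. Frobenius polynomial reducing to
`charpoly σ · charpoly σ'` — `hKW` at `σ` and at `σ'` feeds `hS`, whose shape hypothesis is
witnessed by `ρ` itself; `hS` returns an irreducible automorphic `ρ₀` of the same shape and
residual pair, and `hL` transfers automorphy from `ρ₀` to `ρ`.  Pure logic. -/
theorem phantomRMSector_of_cruxes (hKW : SerreKWAutomorphicGL2) (hS : StableYoshidaCongruence)
    (hL : ResiduallyYoshidaLifting) : PhantomRMSector :=
  fun p _ hp k _ _ _ _ _ red σ σ' hcpt ι ρ hσ hσ' hirr hirr' hdet hnc hρirr hSh =>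
    (hS p hp k red σ σ' (hKW p k red σ hσ hirr) (hKW p k red σ' hσ' hirr') hirr hirr' hdet hnc
        ⟨ρ, hSh⟩ hcpt ι).elim
      fun ρ₀ h₀ =>
        hL p hp k red σ σ' hcpt ι ρ₀ ρ hσ hσ' hirr hirr' hdet hnc h₀.1 h₀.2.1 h₀.2.2 hρirr hSh

/-- **SectorGlue** (item stmt-Langlands-14471 of route PhantomRMYoshida):
`SerreKWAutomorphicGL2 → StableYoshidaCongruence → ResiduallyYoshidaLifting → PhantomRMSector`,
by `phantomRMSector_of_cruxes`. -/
theorem sectorGlue_proof : Summit.Langlands.Langlands.Theses.PhantomRMYoshida.SectorGlue := by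
  unfold Summit.Langlands.Langlands.Theses.PhantomRMYoshida.SectorGlue
  intro hKW hS hL
  exact phantomRMSector_of_cruxes hKW hS hL

end Summit.Langlands.Langlands.Theorems.PhantomRMYoshida
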